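import Literature.NumberTheory.LFunctions.Zhang2022.Section8ProfilePairRow
import Literature.NumberTheory.LFunctions.Zhang2022.Section8ProfileSjPoly
import Literature.NumberTheory.LFunctions.Zhang2022.Section7SjBilinear
import HarnessLib

/-!
# Zhang (2022) §8 for profile data: the row (S) and the repaired K0 asymptotic for KINKED short pieces — finite sums
# `u = Σ_i v_i` of `C²` short pieces of lengths `θ_i ∈ (0,1)` (continuous, piecewise `C²`, finitely many interior kinks)

Topic `Literature/NumberTheory/LFunctions/Zhang2022` (Landau–Siegel audit tree; verdict-neutral). Y. Zhang, *Discrete mean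
estimates and the Landau–Siegel zero*, arXiv:2211.02515v1 (2022) [Zhang2022LandauSiegel] — **an unrefereed manuscript
under adjudication; nothing here asserts or denies its Theorems 1–2; no claim about Landau–Siegel zeros.** Cell
landau-siegel §D, crux K0 = stmt-Parity-20459 `InClassSideTablesPiece` (line «sjrows»), prover ls-knife-K0-p1 g3.

WHY. The registered K0 (`KnifeEdge.InClassMeanPiece c′`) quantifies over KINKED in-class pieces (`Repair.KinkedProfile`:
continuous, a right derivative everywhere, `u′ ∈ L²`); the item's why-fail worries that «a `k ≥ 1` atom at the kink could
still shift the main term at order `𝔞𝔓`». The landed rows cover `C²` and polynomial short pieces (`sjProfileRow_C2`,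
`Section8ProfileSjPoly`). A continuous piecewise-`C²` short piece with kinks at `0 < θ_1 < … < θ_m < 1` is a finite sum
`Σ_i v_i` of `C²` short pieces (telescoping: `v_i = (p_i − p_{i+1})·1_{(−∞,θ_i)}` for `C²` extensions `p_i` of the
restrictions, continuous at `θ_i` since `p_i(θ_i) = u(θ_i) = p_{i+1}(θ_i)`); `S_j(𝐚₁,𝐚₂)` and the constant `𝔪_j` are
bilinear, so the row for the sum follows from the BILINEAR rows of all pairs (`Section8ProfilePairRow.sjPairRow_C2`), and K0
from g0's reduction `inClassMean_short_of_sjRows`. Kinks do NOT shift the main term: it is `𝔅(u) = mainTermForm u u′`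
as for smooth pieces.

* `Sj_sum_sum` (from the tree's `Skeleton.Sj_sum_left/right`), `profTable_finsetSum` — bilinearity bookkeeping;
* `sjProfileMain_finsetSum` — `𝔪_j(Σv_i) = Σ_{i,k} 𝔪_j(v_i, v_k)`; `forAllLarge_finset`;
* `sjProfileRow_of_pairRows` — rows (S) for a sum from the pair rows; **`sjProfileRow_finsetSum_C2`** — row (S) for every
  finite sum of `C²` short pieces;
* **`inClassMean_finsetSum_C2`** — the repaired K0 asymptotic `|Ξ − 𝔅(u)𝔞𝔓| ≤ ε𝔞𝔓` (eventually, under (A), all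
  `c′ ≥ c₀`) for such sums, with any in-class right-derivative datum a.e. equal to `Σ v_i′`;
* `inClassMean_C2` — the one-piece `C²` case packaged the same way;
* `inClassPiece_finsetSum`, **`inClassMean_polyKinked`** — the fully explicit sub-case of CONTINUOUS PIECEWISE-POLYNOMIAL
  short pieces `u = Σ_i polyPiece θ_i q_i` (`q_i(θ_i) = 0`, `0 < θ_i < 1`): splines with arbitrary interior kinks.

## References
* Y. Zhang, arXiv:2211.02515v1 (2022), §7 Prop 7.1 (7.2); §8 Lemma 8.1, (8.10)–(8.12), (8.23), pp. 47–48.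
  [cite: Zhang2022LandauSiegel, §8 pp.47–48, (8.23)]
-/

noncomputable section

open Complex Real MeasureTheory Set intervalIntegral Filter Finset Polynomial
open scoped ComplexConjugate Topology

namespace Literature.NumberTheory.LFunctions.Zhang2022.DipoleRule

open Skeleton KnifeEdge

/-! ### Bilinearity of `S_j` and additivity of the profile table -/

section Bilinear

variable (c' : ℝ) (D : ℕ) (j : ℕ)

/-- **Bilinearity:** `S_j(Σ_i a_i, Σ_k b_k) = Σ_i Σ_k S_j(a_i, b_k)` (lambda form; from the tree's `Skeleton.Sj_sum_left` /
`Skeleton.Sj_sum_right`, `Section7SjBilinear`). [cite: Zhang2022LandauSiegel, §7 Prop 7.1] -/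
theorem Sj_sum_sum {ι : Type*} (s : Finset ι) (a b : ι → ℕ → ℂ) :
    Sj c' D j (fun n => ∑ i ∈ s, a i n) (fun n => ∑ k ∈ s, b k n) = ∑ i ∈ s, ∑ k ∈ s, Sj c' D j (a i) (b k) := by
  rw [← Finset.sum_fn s a, ← Finset.sum_fn s b, Sj_sum_left]
  exact Finset.sum_congr rfl fun i _ => Sj_sum_right c' D j s (a i) b

/-- **The profile table is additive in the profile:** `𝐚_{Σv_i} = Σ 𝐚_{v_i}`. [cite: Zhang2022LandauSiegel, §7 (7.2)] -/
theorem profTable_finsetSum {ι : Type*} (s : Finset ι) (v : ι → ℝ → ℂ) (χ : DirichletCharacter ℂ D) :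
    profTable (fun y => ∑ i ∈ s, v i y) D χ = fun n => ∑ i ∈ s, profTable (v i) D χ n := by
  funext n
  unfold profTable
  split_ifs
  · rw [Finset.mul_sum]
  · simp

end Bilinear

/-! ### The main-term constant of a sum -/

section MainConstant

variable {ι : Type*}

/-- The jet is additive: `𝔧_j(Σv_i) = Σ𝔧_j(v_i)`. [cite: Zhang2022LandauSiegel, §8 Lemma 8.2] -/
theorem k0jet_finsetSum (j : ℕ) (s : Finset ι) (v v' : ι → ℝ → ℂ) (z : ℝ) :
    k0jet j (fun y => ∑ i ∈ s, v i y) (fun y => ∑ i ∈ s, v' i y) z = ∑ i ∈ s, k0jet j (v i) (v' i) z := by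
  unfold k0jet
  rw [Finset.mul_sum, ← Finset.sum_add_distrib]

/-- The mass rule is additive at `z` whenever every summand is integrable on `[z,1]`.
[cite: Zhang2022LandauSiegel, §8 Lemmas 8.3–8.4] -/
theorem k0mass_finsetSum (sS N : ℝ) (s : Finset ι) (w w' : ι → ℝ → ℂ) {z : ℝ}
    (hint : ∀ i ∈ s, IntervalIntegrable (w i) volume z 1) :
    k0mass sS N (fun y => ∑ i ∈ s, w i y) (fun y => ∑ i ∈ s, w' i y) z = ∑ i ∈ s, k0mass sS N (w i) (w' i) z := by
  unfold k0mass
  rw [intervalIntegral.integral_finsetSum hint, Finset.mul_sum, Finset.mul_sum, ← Finset.sum_add_distrib,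
    ← Finset.sum_sub_distrib]

variable {u u' v v' : ℝ → ℂ} {θu θv : ℝ}

/-- **The pair integrand `𝔧_j(u)·𝔪(v̄)` is integrable on `[0,1]`** for two short pieces (`u, u′` continuous on `[0,θ_u]`,
`v, v′` on `[0,θ_v]`, `0 ≤ θ_u, θ_v ≤ 1`, vanishing beyond): continuous on `[0, min]`, zero on `(min, 1]`.
[cite: Zhang2022LandauSiegel, §7 (7.2); §8 (8.11)–(8.12)] -/
theorem intervalIntegrable_k0_pair {j : ℕ} {sS N : ℝ} (hθu0 : 0 ≤ θu) (hθv0 : 0 ≤ θv) (hθu1 : θu ≤ 1)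
    (hθv1 : θv ≤ 1) (hu : ContinuousOn u (Icc 0 θu)) (hu' : ContinuousOn u' (Icc 0 θu))
    (hv : ContinuousOn v (Icc 0 θv)) (hv' : ContinuousOn v' (Icc 0 θv)) (huvan : ∀ y : ℝ, θu ≤ y → u y = 0)
    (huvan' : ∀ y : ℝ, θu < y → u' y = 0) (hvvan : ∀ y : ℝ, θv ≤ y → v y = 0)
    (hvvan' : ∀ y : ℝ, θv < y → v' y = 0) :
    IntervalIntegrable (fun z => k0jet j u u' z * k0mass sS N (fun t => conj (v t)) (fun t => conj (v' t)) z)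
      volume 0 1 := by
  set θ₀ : ℝ := min θu θv with hmin
  have hθ0 : 0 ≤ θ₀ := le_min hθu0 hθv0
  have h0u : θ₀ ≤ θu := min_le_left _ _
  have h0v : θ₀ ≤ θv := min_le_right _ _
  have hθ01 : θ₀ ≤ 1 := h0u.trans hθu1
  set f : ℝ → ℂ := fun z => k0jet j u u' z * k0mass sS N (fun t => conj (v t)) (fun t => conj (v' t)) z with hf
  have hcv1 : ContinuousOn (fun y => conj (v y)) (Icc 0 1) :=
    Complex.continuous_conj.comp_continuousOn (continuousOn_Icc_one_of_short hv hvvan)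
  have htail : ContinuousOn (fun z => ∫ t in z..1, conj (v t)) (Icc 0 1) := by
    have hint : IntegrableOn (fun x => conj (v x)) (Set.uIcc 0 1) volume := by
      rw [Set.uIcc_of_le zero_le_one]
      exact hcv1.integrableOn_compact isCompact_Icc
    have h := intervalIntegral.continuousOn_primitive_interval_left hint
    rwa [Set.uIcc_of_le zero_le_one] at h
  have hzero : ∀ z : ℝ, θ₀ < z → z ≤ 1 → f z = 0 := by
    intro z hz hz1
    rcases le_total θu θv with h | h
    · have hzu : θu < z := by rw [hmin, min_eq_left h] at hz; exact hz
      simp only [hf, k0jet, huvan z hzu.le, huvan' z hzu, mul_zero, add_zero, zero_mul]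
    · have hzv : θv < z := by rw [hmin, min_eq_right h] at hz; exact hz
      have htl : (∫ t in z..1, conj (v t)) = 0 := by
        rw [← intervalIntegral.integral_zero (a := z) (b := (1:ℝ))]
        refine intervalIntegral.integral_congr fun y hy => ?_
        rw [Set.uIcc_of_le hz1] at hy
        simp [hvvan y (hzv.le.trans hy.1)]
      simp only [hf, k0mass, htl, hvvan z hzv.le, hvvan' z hzv, map_zero, mul_zero, sub_zero, add_zero]
  have hK0 : ContinuousOn (fun z => k0mass sS N (fun t => conj (v t)) (fun t => conj (v' t)) z) (Icc 0 θv) := by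
    unfold k0mass
    refine ((continuousOn_const.mul (htail.mono (Icc_subset_Icc le_rfl hθv1))).add
      (continuousOn_const.mul (Complex.continuous_conj.comp_continuousOn hv))).sub
      (Complex.continuous_conj.comp_continuousOn hv')
  have hJ0 : ContinuousOn (k0jet j u u') (Icc 0 θu) := by
    unfold k0jet; exact hu'.add (continuousOn_const.mul hu)
  have hi1 : IntervalIntegrable f volume 0 θ₀ :=
    ContinuousOn.intervalIntegrable (by
      rw [Set.uIcc_of_le hθ0]
      exact (hJ0.mono (Icc_subset_Icc le_rfl h0u)).mul (hK0.mono (Icc_subset_Icc le_rfl h0v)))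
  have hi2 : IntervalIntegrable f volume θ₀ 1 := by
    refine (intervalIntegrable_const (c := (0:ℂ)) (μ := volume) (a := θ₀) (b := 1)).congr ?_
    rw [Set.uIoc_of_le hθ01]
    exact fun z hz => (hzero z hz.1 hz.2).symm
  exact hi1.trans hi2

/-- **The main-term constant of a finite sum of short pieces:** `𝔪_j(Σ_i v_i) = Σ_i Σ_k 𝔪_j(v_i, v_k)` (the jet and the
mass rule are additive; every pair integrand is integrable on `[0,1]`). [cite: Zhang2022LandauSiegel, §8 (8.10)–(8.12)] -/
theorem sjProfileMain_finsetSum (j : ℕ) (s : Finset ι) (θ : ι → ℝ) (v v' : ι → ℝ → ℂ)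
    (hθ : ∀ i ∈ s, 0 ≤ θ i ∧ θ i ≤ 1) (hv : ∀ i ∈ s, ContinuousOn (v i) (Icc 0 (θ i)))
    (hv' : ∀ i ∈ s, ContinuousOn (v' i) (Icc 0 (θ i))) (hvan : ∀ i ∈ s, ∀ y : ℝ, θ i ≤ y → v i y = 0)
    (hvan' : ∀ i ∈ s, ∀ y : ℝ, θ i < y → v' i y = 0) :
    sjProfileMain j (fun y => ∑ i ∈ s, v i y) (fun y => ∑ i ∈ s, v' i y)
      = ∑ i ∈ s, ∑ k ∈ s, sjPairMain j (v i) (v' i) (v k) (v' k) := by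
  have hc1 : ∀ i ∈ s, ContinuousOn (fun y => conj (v i y)) (Icc 0 1) := fun i hi =>
    Complex.continuous_conj.comp_continuousOn (continuousOn_Icc_one_of_short (hv i hi) (hvan i hi))
  -- pointwise identity on `[0,1]`
  have hpt : ∀ z ∈ Set.uIcc (0:ℝ) 1,
      k0jet j (fun y => ∑ i ∈ s, v i y) (fun y => ∑ i ∈ s, v' i y) z *
          k0mass (Repair.bS j) (Repair.bN j) (fun t => conj (∑ i ∈ s, v i t)) (fun t => conj (∑ i ∈ s, v' i t)) z
        = ∑ i ∈ s, ∑ k ∈ s, k0jet j (v i) (v' i) z *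
            k0mass (Repair.bS j) (Repair.bN j) (fun t => conj (v k t)) (fun t => conj (v' k t)) z := by
    intro z hz
    rw [Set.uIcc_of_le zero_le_one] at hz
    have e1 : (fun t => conj (∑ i ∈ s, v i t)) = fun t => ∑ i ∈ s, conj (v i t) := by
      funext t; exact map_sum _ _ _
    have e2 : (fun t => conj (∑ i ∈ s, v' i t)) = fun t => ∑ i ∈ s, conj (v' i t) := by
      funext t; exact map_sum _ _ _
    rw [e1, e2, k0jet_finsetSum, k0mass_finsetSum (Repair.bS j) (Repair.bN j) s _ _ ?_]
    · exact Finset.sum_mul_sum _ _ _ _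
    · intro i hi
      exact ContinuousOn.intervalIntegrable (by
        rw [Set.uIcc_of_le hz.2]; exact (hc1 i hi).mono (Icc_subset_Icc hz.1 le_rfl))
  unfold sjProfileMain sjPairMain
  rw [intervalIntegral.integral_congr hpt, intervalIntegral.integral_finsetSum, Finset.mul_sum]
  · refine Finset.sum_congr rfl fun i hi => ?_
    rw [intervalIntegral.integral_finsetSum, Finset.mul_sum]
    intro k hk
    exact intervalIntegrable_k0_pair (hθ i hi).1 (hθ k hk).1 (hθ i hi).2 (hθ k hk).2 (hv i hi) (hv' i hi) (hv k hk)
      (hv' k hk) (hvan i hi) (hvan' i hi) (hvan k hk) (hvan' k hk)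
  · intro i hi
    have hs := IntervalIntegrable.sum s (μ := volume) (a := (0:ℝ)) (b := 1)
      (f := fun k => fun z => k0jet j (v i) (v' i) z *
        k0mass (Repair.bS j) (Repair.bN j) (fun t => conj (v k t)) (fun t => conj (v' k t)) z)
      fun k hk => intervalIntegrable_k0_pair (hθ i hi).1 (hθ k hk).1 (hθ i hi).2 (hθ k hk).2 (hv i hi) (hv' i hi)
        (hv k hk) (hv' k hk) (hvan i hi) (hvan' i hi) (hvan k hk) (hvan' k hk)
    rw [Finset.sum_fn] at hs
    exact hs

end MainConstant

/-! ### Rows (S) for a finite sum from the pair rows -/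

section Rows

variable {ι : Type*}

/-- Finitely many eventual statements hold eventually together. [cite: Zhang2022LandauSiegel, §2 p.4] -/
theorem forAllLarge_finset (s : Finset ι) {P : ι → (D : ℕ) → [NeZero D] → DirichletCharacter ℂ D → Prop}
    (h : ∀ i ∈ s, ForAllLarge (P i)) : ForAllLarge fun D _ χ => ∀ i ∈ s, P i D χ := by
  classical
  induction s using Finset.induction_on with
  | empty => exact ForAllLarge.of_le 0 fun D _ χ _ _ _ => by simp
  | insert a s ha ih =>
    have h1 : ForAllLarge (P a) := h a (Finset.mem_insert_self a s)
    have h2 := ih fun i hi => h i (Finset.mem_insert_of_mem hi)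
    refine (h1.and h2).mono ?_
    intro D _ χ _ _ hh i hi
    rcases Finset.mem_insert.mp hi with rfl | hi'
    · exact hh.1
    · exact hh.2 i hi'

/-- **Row (S) for a finite sum from the bilinear rows of all pairs:** if `𝔪_j(Σv_i) = ΣΣ𝔪_j(v_i,v_k)` and
`SjPairRow c′ j v_i v_i′ v_k v_k′` for all `i, k ∈ s`, then `SjProfileRow c′ j (Σv_i) (Σv_i′)`.
[cite: Zhang2022LandauSiegel, §8 (8.9)–(8.12)] -/
theorem sjProfileRow_of_pairRows (c' : ℝ) (j : ℕ) (s : Finset ι) (v v' : ι → ℝ → ℂ)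
    (hmain : sjProfileMain j (fun y => ∑ i ∈ s, v i y) (fun y => ∑ i ∈ s, v' i y)
      = ∑ i ∈ s, ∑ k ∈ s, sjPairMain j (v i) (v' i) (v k) (v' k))
    (hrows : ∀ i ∈ s, ∀ k ∈ s, SjPairRow c' j (v i) (v' i) (v k) (v' k)) :
    SjProfileRow c' j (fun y => ∑ i ∈ s, v i y) (fun y => ∑ i ∈ s, v' i y) := by
  intro ε hε
  set N : ℝ := (s.card : ℝ) ^ 2 + 1 with hN
  have hN0 : 0 < N := by positivity
  have hε' : 0 < ε / N := div_pos hε hN0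
  obtain ⟨a₀, ha₀, hAlow⟩ := frakALowerBound_holds
  have hall : ForAllLarge fun D _ χ => ∀ p ∈ s ×ˢ s, (AssumptionA D χ →
      ‖(alpha D : ℂ)⁻¹ * Sj c' D j (profTable (v p.1) D χ) (fun n => conj (profTable (v p.2) D χ n))
          - sjPairMain j (v p.1) (v' p.1) (v p.2) (v' p.2) * frakA χ‖ ≤ ε / N * frakA χ) :=
    forAllLarge_finset (s ×ˢ s) fun p hp => by
      rw [Finset.mem_product] at hp
      exact hrows p.1 hp.1 p.2 hp.2 (ε / N) hε'
  refine (hall.and hAlow).mono ?_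
  intro D _ χ _ _ ⟨hh, hAD⟩ hA
  have hA0 : 0 ≤ frakA χ := ha₀.le.trans (hAD hA)
  -- expand both sides as double sums
  have hS : Sj c' D j (profTable (fun y => ∑ i ∈ s, v i y) D χ)
      (fun n => conj (profTable (fun y => ∑ i ∈ s, v i y) D χ n))
      = ∑ i ∈ s, ∑ k ∈ s, Sj c' D j (profTable (v i) D χ) (fun n => conj (profTable (v k) D χ n)) := by
    rw [profTable_finsetSum]
    have e : (fun n => conj ((fun n => ∑ i ∈ s, profTable (v i) D χ n) n))
        = fun n => ∑ k ∈ s, conj (profTable (v k) D χ n) := by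
      funext n; exact map_sum _ _ _
    rw [e]
    exact Sj_sum_sum c' D j s _ _
  have hdiff : (alpha D : ℂ)⁻¹ * Sj c' D j (profTable (fun y => ∑ i ∈ s, v i y) D χ)
        (fun n => conj (profTable (fun y => ∑ i ∈ s, v i y) D χ n))
      - sjProfileMain j (fun y => ∑ i ∈ s, v i y) (fun y => ∑ i ∈ s, v' i y) * frakA χ
      = ∑ i ∈ s, ∑ k ∈ s, ((alpha D : ℂ)⁻¹ * Sj c' D j (profTable (v i) D χ) (fun n => conj (profTable (v k) D χ n))
          - sjPairMain j (v i) (v' i) (v k) (v' k) * frakA χ) := by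
    rw [hS, hmain, Finset.mul_sum, Finset.sum_mul, ← Finset.sum_sub_distrib]
    refine Finset.sum_congr rfl fun i _ => ?_
    rw [Finset.mul_sum, Finset.sum_mul, ← Finset.sum_sub_distrib]
  rw [hdiff]
  calc ‖∑ i ∈ s, ∑ k ∈ s, ((alpha D : ℂ)⁻¹ * Sj c' D j (profTable (v i) D χ) (fun n => conj (profTable (v k) D χ n))
          - sjPairMain j (v i) (v' i) (v k) (v' k) * frakA χ)‖
      ≤ ∑ i ∈ s, ‖∑ k ∈ s, ((alpha D : ℂ)⁻¹ * Sj c' D j (profTable (v i) D χ) (fun n => conj (profTable (v k) D χ n))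
          - sjPairMain j (v i) (v' i) (v k) (v' k) * frakA χ)‖ := norm_sum_le _ _
    _ ≤ ∑ i ∈ s, ∑ k ∈ s, ‖(alpha D : ℂ)⁻¹ * Sj c' D j (profTable (v i) D χ) (fun n => conj (profTable (v k) D χ n))
          - sjPairMain j (v i) (v' i) (v k) (v' k) * frakA χ‖ := Finset.sum_le_sum fun i _ => norm_sum_le _ _
    _ ≤ ∑ i ∈ s, ∑ k ∈ s, ε / N * frakA χ :=
        Finset.sum_le_sum fun i hi => Finset.sum_le_sum fun k hk => hh (i, k) (Finset.mem_product.mpr ⟨hi, hk⟩) hA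
    _ = (s.card : ℝ) ^ 2 * (ε / N * frakA χ) := by
        rw [Finset.sum_const, Finset.sum_const, nsmul_eq_mul, nsmul_eq_mul]; ring
    _ ≤ N * (ε / N * frakA χ) := by
        apply mul_le_mul_of_nonneg_right _ (mul_nonneg hε'.le hA0)
        linarith
    _ = ε * frakA χ := by field_simp

/-- **ROW (S) FOR A FINITE SUM OF `C²` SHORT PIECES (kinked pieces):** for every `c′`, `j ∈ {1,2,3}` and every finite family
of `C²` short pieces `v_i` of lengths `θ_i ∈ (0,1)` (`v_i, v_i′, v_i″` continuous on `[0,θ_i]`, `HasDerivAt` below `θ_i`,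
`v_i = 0` on `[θ_i,∞)`, `v_i′ = 0` on `(θ_i,∞)`): `SjProfileRow c′ j (Σv_i) (Σv_i′)`.
[cite: Zhang2022LandauSiegel, §8 Lemmas 8.2–8.4, (8.10)–(8.12), pp.47–48] -/
theorem sjProfileRow_finsetSum_C2 (c' : ℝ) (s : Finset ι) (θ : ι → ℝ) (v v' v'' : ι → ℝ → ℂ)
    (hθ : ∀ i ∈ s, 0 < θ i ∧ θ i < 1) (hv : ∀ i ∈ s, ContinuousOn (v i) (Icc 0 (θ i)))
    (hv' : ∀ i ∈ s, ContinuousOn (v' i) (Icc 0 (θ i))) (hv'' : ∀ i ∈ s, ContinuousOn (v'' i) (Icc 0 (θ i)))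
    (hd : ∀ i ∈ s, ∀ y : ℝ, y < θ i → HasDerivAt (v i) (v' i y) y)
    (hd' : ∀ i ∈ s, ∀ y : ℝ, y < θ i → HasDerivAt (v' i) (v'' i y) y)
    (hvan : ∀ i ∈ s, ∀ y : ℝ, θ i ≤ y → v i y = 0) (hvan' : ∀ i ∈ s, ∀ y : ℝ, θ i < y → v' i y = 0) {j : ℕ}
    (hj : j ∈ ({1, 2, 3} : Finset ℕ)) :
    SjProfileRow c' j (fun y => ∑ i ∈ s, v i y) (fun y => ∑ i ∈ s, v' i y) := by
  refine sjProfileRow_of_pairRows c' j s v v' ?_ ?_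
  · exact sjProfileMain_finsetSum j s θ v v' (fun i hi => ⟨(hθ i hi).1.le, (hθ i hi).2.le⟩) hv hv' hvan hvan'
  · intro i hi k hk
    exact sjPairRow_C2 c' (hθ i hi).1 (hθ i hi).2 (hθ k hk).1 (hθ k hk).2 (hv i hi) (hv' i hi) (hv'' i hi) (hd i hi)
      (hd' i hi) (hvan i hi) (hvan' i hi) (hv k hk) (hv' k hk) (hv'' k hk) (hd k hk) (hd' k hk) (hvan k hk) (hvan' k hk)
      hj

end Rows

/-! ### The repaired K0 asymptotic for kinked short pieces -/

section K0

variable {ι : Type*}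

/-- **THE REPAIRED K0 ASYMPTOTIC FOR FINITE SUMS OF `C²` SHORT PIECES:** there is `c₀ ≥ 0` such that for every `c′ ≥ c₀`,
every finite family of `C²` short pieces `v_i` of lengths `θ_i ∈ (0,1)` as in `sjProfileRow_finsetSum_C2`, every in-class
right-derivative datum `w′` of `u = Σv_i` (i.e. `InClassPiece u w′`) agreeing a.e. on `(0,1]` with `Σv_i′`, and every
`ε > 0`: eventually in `D` under (A), `|discMean c′ χ (profPoly χ · u (⌊P⌋+1)) − mainTermForm u w′·𝔞𝔓| ≤ ε𝔞𝔓`. KINKS DO NOT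
SHIFT THE MAIN TERM. [cite: Zhang2022LandauSiegel, §7 Prop 7.1, §8 Lemma 8.1, (8.23)] -/
theorem inClassMean_finsetSum_C2 :
    ∃ c₀ : ℝ, 0 ≤ c₀ ∧ ∀ c' : ℝ, c₀ ≤ c' → ∀ (s : Finset ι) (θ : ι → ℝ) (v v' v'' : ι → ℝ → ℂ) (w' : ℝ → ℂ),
      (∀ i ∈ s, 0 < θ i ∧ θ i < 1) → (∀ i ∈ s, ContinuousOn (v i) (Icc 0 (θ i))) →
      (∀ i ∈ s, ContinuousOn (v' i) (Icc 0 (θ i))) → (∀ i ∈ s, ContinuousOn (v'' i) (Icc 0 (θ i))) →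
      (∀ i ∈ s, ∀ y : ℝ, y < θ i → HasDerivAt (v i) (v' i y) y) →
      (∀ i ∈ s, ∀ y : ℝ, y < θ i → HasDerivAt (v' i) (v'' i y) y) →
      (∀ i ∈ s, ∀ y : ℝ, θ i ≤ y → v i y = 0) → (∀ i ∈ s, ∀ y : ℝ, θ i < y → v' i y = 0) →
      InClassPiece (fun y => ∑ i ∈ s, v i y) w' →
      (∀ᵐ z ∂volume, z ∈ Set.uIoc (0:ℝ) 1 → (∑ i ∈ s, v' i z) = w' z) →
      ∀ ε : ℝ, 0 < ε → ForAllLarge fun D _ χ => AssumptionA D χ →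
        |discMean c' χ (fun x t => profPoly χ x (fun y => ∑ i ∈ s, v i y) (⌊bigP D⌋₊ + 1) t)
            - mainTermForm (fun y => ∑ i ∈ s, v i y) w' * frakA χ * frakP D| ≤ ε * frakA χ * frakP D := by
  obtain ⟨c₀, hc0, h⟩ := inClassMean_short_of_sjRows
  refine ⟨c₀, hc0, fun c' hc' s θ v v' v'' w' hθ hv hv' hv'' hd hd' hvan hvan' hcl hae => ?_⟩
  classical
  -- a common length `Θ < 1` beyond which the sum vanishes
  set Θ : ℝ := if hs : s.Nonempty then s.sup' hs θ else 0 with hΘ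
  have hΘ1 : Θ < 1 := by
    rw [hΘ]; split_ifs with hs
    · exact (Finset.sup'_lt_iff hs).mpr fun i hi => (hθ i hi).2
    · exact zero_lt_one
  have hle : ∀ i ∈ s, θ i ≤ Θ := by
    intro i hi
    rw [hΘ, dif_pos ⟨i, hi⟩]
    exact Finset.le_sup' θ hi
  have hvanΘ : ∀ y : ℝ, Θ ≤ y → (fun y => ∑ i ∈ s, v i y) y = 0 := by
    intro y hy
    exact Finset.sum_eq_zero fun i hi => hvan i hi y ((hle i hi).trans hy)
  have hrow : ∀ j ∈ ({1, 2, 3} : Finset ℕ), SjProfileRow c' j (fun y => ∑ i ∈ s, v i y) w' := by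
    intro j hj
    exact sjProfileRow_congr_ae hae (sjProfileRow_finsetSum_C2 c' s θ v v' v'' hθ hv hv' hv'' hd hd' hvan hvan' hj)
  exact h c' hc' _ w' Θ hcl hΘ1 hvanΘ (hrow 1 (by simp)) (hrow 2 (by simp)) (hrow 3 (by simp))

/-- **The one-piece case packaged: K0 for ONE `C²` short piece** of length `θ ∈ (0,1)` with any in-class right-derivative
datum `w′` a.e. equal to `u′` on `(0,1]` (`sjProfileRow_C2` + `inClassMean_short_of_sjRows`).
[cite: Zhang2022LandauSiegel, §7 Prop 7.1, §8 Lemma 8.1, (8.23)] -/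
theorem inClassMean_C2 :
    ∃ c₀ : ℝ, 0 ≤ c₀ ∧ ∀ c' : ℝ, c₀ ≤ c' → ∀ (θ : ℝ) (u u' u'' w' : ℝ → ℂ), 0 < θ → θ < 1 →
      ContinuousOn u (Icc 0 θ) → ContinuousOn u' (Icc 0 θ) → ContinuousOn u'' (Icc 0 θ) →
      (∀ y : ℝ, y < θ → HasDerivAt u (u' y) y) → (∀ y : ℝ, y < θ → HasDerivAt u' (u'' y) y) →
      (∀ y : ℝ, θ ≤ y → u y = 0) → (∀ y : ℝ, θ < y → u' y = 0) → InClassPiece u w' →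
      (∀ᵐ z ∂volume, z ∈ Set.uIoc (0:ℝ) 1 → u' z = w' z) →
      ∀ ε : ℝ, 0 < ε → ForAllLarge fun D _ χ => AssumptionA D χ →
        |discMean c' χ (fun x t => profPoly χ x u (⌊bigP D⌋₊ + 1) t) - mainTermForm u w' * frakA χ * frakP D|
          ≤ ε * frakA χ * frakP D := by
  obtain ⟨c₀, hc0, h⟩ := inClassMean_short_of_sjRows
  refine ⟨c₀, hc0, fun c' hc' θ u u' u'' w' hθ0 hθ1 hu hu' hu'' hd hd' hvan hvan' hcl hae => ?_⟩
  have hrow : ∀ j ∈ ({1, 2, 3} : Finset ℕ), SjProfileRow c' j u w' := fun j hj =>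
    sjProfileRow_congr_ae hae (sjProfileRow_C2 c' hθ0 hθ1 hu hu' hu'' hd hd' hvan hvan' hj)
  exact h c' hc' u w' θ hcl hθ1 hvan (hrow 1 (by simp)) (hrow 2 (by simp)) (hrow 3 (by simp))

/-! #### Continuous piecewise-polynomial short pieces (splines with kinks) -/

/-- In-class pieces are closed under addition. [cite: Zhang2022LandauSiegel, §7 Prop 7.1 p.44, (7.2)] -/
theorem inClassPiece_add {u u' f f' : ℝ → ℂ} (hu : InClassPiece u u') (hf : InClassPiece f f') :
    InClassPiece (fun x => u x + f x) (fun x => u' x + f' x) where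
  kinked := by simpa using hu.kinked.add_smul hf.kinked 1
  vanish := fun y hy => by simp [hu.vanish y hy, hf.vanish y hy]
  vanish' := fun y hy => by simp [hu.vanish' y hy, hf.vanish' y hy]

/-- **A finite sum of in-class pieces is an in-class piece.** [cite: Zhang2022LandauSiegel, §7 Prop 7.1 p.44, (7.2)] -/
theorem inClassPiece_finsetSum (s : Finset ι) (v v' : ι → ℝ → ℂ) (h : ∀ i ∈ s, InClassPiece (v i) (v' i)) :
    InClassPiece (fun y => ∑ i ∈ s, v i y) (fun y => ∑ i ∈ s, v' i y) := by
  classical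
  induction s using Finset.induction_on with
  | empty => simpa using (polyShortPiece_zero (θ := (0:ℝ)) zero_le_one).inClassPiece
  | insert a s ha ih =>
    have h1 : InClassPiece (v a) (v' a) := h a (Finset.mem_insert_self a s)
    have h2 := ih fun i hi => h i (Finset.mem_insert_of_mem hi)
    have h3 := inClassPiece_add h1 h2
    simp only [Finset.sum_insert ha]
    exact h3

/-- The real trace of a complex polynomial has real derivative `p′(x)`. [folklore] -/
private theorem hasDerivAt_polyEval_ofReal'' (p : ℂ[X]) (x : ℝ) :
    HasDerivAt (fun y : ℝ => p.eval (y : ℂ)) ((derivative p).eval (x : ℂ)) x :=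
  (p.hasDerivAt (x : ℂ)).comp_ofReal

/-- **THE REPAIRED K0 ASYMPTOTIC FOR CONTINUOUS PIECEWISE-POLYNOMIAL SHORT PIECES (splines with kinks):** there is
`c₀ ≥ 0` such that for every `c′ ≥ c₀`, every finite family of polynomials `q_i` and heights `θ_i ∈ (0,1)` with
`q_i(θ_i) = 0`, the profile `u = Σ_i polyPiece θ_i q_i` (any continuous piecewise-polynomial function on `[0,∞)` with
breakpoints `θ_1 < … < θ_m < 1` vanishing from `θ_m` on is of this form) with its right derivative `u′ = Σ_i polyPieceDeriv θ_i q_i`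
satisfies, for every `ε > 0`, eventually in `D` under (A): `|discMean c′ χ (profPoly χ · u (⌊P⌋+1)) − mainTermForm u u′·𝔞𝔓| ≤ ε𝔞𝔓`.
[cite: Zhang2022LandauSiegel, §7 Prop 7.1, §8 Lemma 8.1, (8.23)] -/
theorem inClassMean_polyKinked :
    ∃ c₀ : ℝ, 0 ≤ c₀ ∧ ∀ c' : ℝ, c₀ ≤ c' → ∀ (s : Finset ι) (θ : ι → ℝ) (q : ι → ℂ[X]),
      (∀ i ∈ s, 0 < θ i ∧ θ i < 1 ∧ (q i).eval ((θ i : ℝ) : ℂ) = 0) →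
      ∀ ε : ℝ, 0 < ε → ForAllLarge fun D _ χ => AssumptionA D χ →
        |discMean c' χ (fun x t => profPoly χ x (fun y => ∑ i ∈ s, polyPiece (θ i) (q i) y) (⌊bigP D⌋₊ + 1) t)
            - mainTermForm (fun y => ∑ i ∈ s, polyPiece (θ i) (q i) y)
                (fun y => ∑ i ∈ s, polyPieceDeriv (θ i) (q i) y) * frakA χ * frakP D|
          ≤ ε * frakA χ * frakP D := by
  obtain ⟨c₀, hc0, h⟩ := (inClassMean_finsetSum_C2 (ι := ι))
  refine ⟨c₀, hc0, fun c' hc' s θ q hq ε hε => ?_⟩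
  -- the `C²` data of each piece: `v_i′ = q_i′·1_{(-∞,θ_i]}`, `v_i″ = q_i″`
  set v : ι → ℝ → ℂ := fun i => polyPiece (θ i) (q i) with hvdef
  set v' : ι → ℝ → ℂ := fun i y => if y ≤ θ i then (derivative (q i)).eval (y : ℂ) else 0 with hv'def
  set v'' : ι → ℝ → ℂ := fun i y => (derivative (derivative (q i))).eval (y : ℂ) with hv''def
  have hθ : ∀ i ∈ s, 0 < θ i ∧ θ i < 1 := fun i hi => ⟨(hq i hi).1, (hq i hi).2.1⟩
  have hv : ∀ i ∈ s, ContinuousOn (v i) (Icc 0 (θ i)) := fun i hi => (continuous_polyPiece (hq i hi).2.2).continuousOn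
  have hv' : ∀ i ∈ s, ContinuousOn (v' i) (Icc 0 (θ i)) := fun i hi =>
    ((derivative (q i)).continuous.comp continuous_ofReal).continuousOn.congr fun y hy => by simp [hv'def, hy.2]
  have hv'' : ∀ i ∈ s, ContinuousOn (v'' i) (Icc 0 (θ i)) := fun i hi =>
    ((derivative (derivative (q i))).continuous.comp continuous_ofReal).continuousOn
  have hd : ∀ i ∈ s, ∀ y : ℝ, y < θ i → HasDerivAt (v i) (v' i y) y := by
    intro i hi y hy
    have hev : v i =ᶠ[𝓝 y] fun x : ℝ => (q i).eval (x : ℂ) :=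
      eventually_of_mem (Iio_mem_nhds hy) fun x hx => polyPiece_of_lt hx
    have h1 := (hasDerivAt_polyEval_ofReal'' (q i) y).congr_of_eventuallyEq hev
    have e : v' i y = (derivative (q i)).eval (y : ℂ) := by simp [hv'def, hy.le]
    rw [e]; exact h1
  have hd' : ∀ i ∈ s, ∀ y : ℝ, y < θ i → HasDerivAt (v' i) (v'' i y) y := by
    intro i hi y hy
    have hev : v' i =ᶠ[𝓝 y] fun x : ℝ => (derivative (q i)).eval (x : ℂ) :=
      eventually_of_mem (Iio_mem_nhds hy) fun x hx => by simp [hv'def, (Set.mem_Iio.mp hx).le]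
    exact (hasDerivAt_polyEval_ofReal'' (derivative (q i)) y).congr_of_eventuallyEq hev
  have hvan : ∀ i ∈ s, ∀ y : ℝ, θ i ≤ y → v i y = 0 := fun i hi y hy => polyPiece_of_le hy
  have hvan' : ∀ i ∈ s, ∀ y : ℝ, θ i < y → v' i y = 0 := fun i hi y hy => by simp [hv'def, not_le.mpr hy]
  -- the in-class datum `Σ polyPieceDeriv` and its a.e. agreement with `Σ v_i′`
  have hcl : InClassPiece (fun y => ∑ i ∈ s, v i y) (fun y => ∑ i ∈ s, polyPieceDeriv (θ i) (q i) y) :=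
    inClassPiece_finsetSum s v _ fun i hi =>
      (show PolyShortPiece (θ i) (v i) (polyPieceDeriv (θ i) (q i)) from
        ⟨(hq i hi).2.1.le, q i, (hq i hi).2.2, rfl, rfl⟩).inClassPiece
  have hae : ∀ᵐ z ∂(volume : Measure ℝ), z ∈ Set.uIoc (0:ℝ) 1 →
      (∑ i ∈ s, v' i z) = ∑ i ∈ s, polyPieceDeriv (θ i) (q i) z := by
    have hfin : ((s.image θ : Finset ℝ) : Set ℝ).Finite := Finset.finite_toSet _
    have hnull : volume ((s.image θ : Finset ℝ) : Set ℝ) = 0 := hfin.measure_zero volume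
    filter_upwards [measure_eq_zero_iff_ae_notMem.mp hnull] with z hz _
    refine Finset.sum_congr rfl fun i hi => ?_
    have hzi : z ≠ θ i := fun e => hz (by rw [Finset.mem_coe, Finset.mem_image]; exact ⟨i, hi, e.symm⟩)
    rcases lt_or_gt_of_ne hzi with hlt | hgt
    · simp [hv'def, hlt.le, polyPieceDeriv_of_lt hlt]
    · simp [hv'def, not_le.mpr hgt, polyPieceDeriv_of_le hgt.le]
  exact h c' hc' s θ v v' v'' _ hθ hv hv' hv'' hd hd' hvan hvan' hcl hae ε hε

end K0

end Literature.NumberTheory.LFunctions.Zhang2022.DipoleRule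

end
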